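import Mathlib.Analysis.SpecialFunctions.ImproperIntegrals
import HarnessLib

/-!
# The Cauchy–Poisson integral `∫ dy / (a² + y²) = π / |a|`

A Mathlib-only leaf file of shared micro-lemmas (librarian refactor): integrability and the value
of the integral of `y ↦ (a² + y²)⁻¹` over `ℝ`, in the syntactic forms that occur in the tree
(`(a² + y²)⁻¹`, `(y² + a²)⁻¹`, `1 / (a² + y²)`, and the translates `((z - y)² + a²)⁻¹`,
`(a² + (γ + y)²)⁻¹`). Everything is an immediate consequence of Mathlib's
`integral_univ_inv_one_add_sq : ∫ x, (1 + x²)⁻¹ = π` and `integrable_inv_one_add_sq` by the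
substitution `y = a x` and translation invariance of Lebesgue measure.

At the time of writing the tree carried eleven local copies of these statements
(`integral_inv_sq_add_sq` / `integrable_inv_sq_add_sq` in `NumberTheory/LFunctions` ×7,
`NumberTheory/Sieve`, `Analysis/FluidPDE`, `Analysis/Complex`, `Analysis/SpecialFunctions`);
new files should import this one instead, and the copies are to become deprecated aliases
(librarian sweep g14, refactor item). Deliberately NOT here: the complex-parameter version
`∫ dt / (t² + w)`, `w ∈ ℂ ∖ (-∞, 0]` (`ArcsinePoissonIntegral.lean`).

## References

* Folklore; e.g. E. M. Stein, R. Shakarchi, *Real Analysis* (2005), Ch. 3 §2.1 (the Poisson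
  kernel `P_a(y) = a / (π (a² + y²))` on the line has total mass one).
-/

noncomputable section

open Real MeasureTheory

namespace Literature.Analysis.SpecialFunctions

/-- Pointwise identity behind the substitution `y = a x`:
`(a² + (a x)²)⁻¹ = (a²)⁻¹ (1 + x²)⁻¹`. [folklore] -/
theorem inv_sq_add_mul_sq (a x : ℝ) : (a ^ 2 + (a * x) ^ 2)⁻¹ = (a ^ 2)⁻¹ * (1 + x ^ 2)⁻¹ := by
  rw [← mul_inv, mul_add, mul_one, mul_pow]

/-- `y ↦ (a² + y²)⁻¹` is integrable on `ℝ` for `a ≠ 0`. [folklore] -/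
theorem integrable_inv_sq_add_sq_of_ne_zero {a : ℝ} (ha : a ≠ 0) :
    Integrable fun y : ℝ => (a ^ 2 + y ^ 2)⁻¹ := by
  have h := (integrable_inv_one_add_sq.comp_div ha).const_mul (a ^ 2)⁻¹
  refine h.congr (Filter.Eventually.of_forall fun y => ?_)
  show (a ^ 2)⁻¹ * (1 + (y / a) ^ 2)⁻¹ = (a ^ 2 + y ^ 2)⁻¹
  rw [← inv_sq_add_mul_sq, mul_div_cancel₀ y ha]

/-- `y ↦ (y² + a²)⁻¹` is integrable on `ℝ` for `a ≠ 0`. [folklore] -/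
theorem integrable_inv_sq_add_sq_of_ne_zero' {a : ℝ} (ha : a ≠ 0) :
    Integrable fun y : ℝ => (y ^ 2 + a ^ 2)⁻¹ := by
  simpa only [add_comm] using integrable_inv_sq_add_sq_of_ne_zero ha

/-- `y ↦ 1 / (a² + y²)` is integrable on `ℝ` for `a ≠ 0`. [folklore] -/
theorem integrable_one_div_sq_add_sq_of_ne_zero {a : ℝ} (ha : a ≠ 0) :
    Integrable fun y : ℝ => 1 / (a ^ 2 + y ^ 2) := by
  simpa only [one_div] using integrable_inv_sq_add_sq_of_ne_zero ha

/-- `y ↦ 1 / (y² + a²)` is integrable on `ℝ` for `a ≠ 0`. [folklore] -/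
theorem integrable_one_div_sq_add_sq_of_ne_zero' {a : ℝ} (ha : a ≠ 0) :
    Integrable fun y : ℝ => 1 / (y ^ 2 + a ^ 2) := by
  simpa only [one_div] using integrable_inv_sq_add_sq_of_ne_zero' ha

/-- **`∫_ℝ dy / (a² + y²) = π / |a|`** for `a ≠ 0` (substitute `y = a x` in
`∫ (1 + x²)⁻¹ = π`). [folklore] -/
theorem integral_inv_sq_add_sq_eq_pi_div_abs {a : ℝ} (ha : a ≠ 0) :
    ∫ y : ℝ, (a ^ 2 + y ^ 2)⁻¹ = π / |a| := by
  have hab : |a| ≠ 0 := abs_ne_zero.mpr ha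
  have h := Measure.integral_comp_mul_left (fun y : ℝ => (a ^ 2 + y ^ 2)⁻¹) a
  have heq : (fun x : ℝ => (a ^ 2 + (a * x) ^ 2)⁻¹) = fun x => (a ^ 2)⁻¹ * (1 + x ^ 2)⁻¹ :=
    funext (inv_sq_add_mul_sq a)
  rw [heq, integral_const_mul, integral_univ_inv_one_add_sq, smul_eq_mul, abs_inv] at h
  -- `h : (a ^ 2)⁻¹ * π = |a|⁻¹ * ∫ y, (a ^ 2 + y ^ 2)⁻¹`
  have hI : ∫ y : ℝ, (a ^ 2 + y ^ 2)⁻¹ = |a| * ((a ^ 2)⁻¹ * π) := by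
    rw [h, ← mul_assoc, mul_inv_cancel₀ hab, one_mul]
  rw [hI, ← sq_abs a]
  field_simp

/-- **`∫_ℝ dy / (a² + y²) = π / a`** for `0 < a`. [folklore] -/
theorem integral_inv_sq_add_sq_eq_pi_div {a : ℝ} (ha : 0 < a) :
    ∫ y : ℝ, (a ^ 2 + y ^ 2)⁻¹ = π / a := by
  rw [integral_inv_sq_add_sq_eq_pi_div_abs ha.ne', abs_of_pos ha]

/-- `∫_ℝ dy / (y² + a²) = π / a` for `0 < a`. [folklore] -/
theorem integral_inv_sq_add_sq_eq_pi_div' {a : ℝ} (ha : 0 < a) :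
    ∫ y : ℝ, (y ^ 2 + a ^ 2)⁻¹ = π / a := by
  simpa only [add_comm] using integral_inv_sq_add_sq_eq_pi_div ha

/-- `∫_ℝ 1 / (a² + y²) dy = π / a` for `0 < a`. [folklore] -/
theorem integral_one_div_sq_add_sq_eq_pi_div {a : ℝ} (ha : 0 < a) :
    ∫ y : ℝ, 1 / (a ^ 2 + y ^ 2) = π / a := by
  simpa only [one_div] using integral_inv_sq_add_sq_eq_pi_div ha

/-- `∫_ℝ 1 / (y² + a²) dy = π / a` for `0 < a`. [folklore] -/
theorem integral_one_div_sq_add_sq_eq_pi_div' {a : ℝ} (ha : 0 < a) :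
    ∫ y : ℝ, 1 / (y ^ 2 + a ^ 2) = π / a := by
  simpa only [one_div] using integral_inv_sq_add_sq_eq_pi_div' ha

/-- Translate: `∫_ℝ dy / ((z - y)² + a²) = π / a` for `0 < a`. [folklore] -/
theorem integral_inv_sub_sq_add_sq_eq_pi_div {a : ℝ} (ha : 0 < a) (z : ℝ) :
    ∫ y : ℝ, ((z - y) ^ 2 + a ^ 2)⁻¹ = π / a := by
  rw [integral_sub_left_eq_self (fun y : ℝ => (y ^ 2 + a ^ 2)⁻¹) volume z]
  exact integral_inv_sq_add_sq_eq_pi_div' ha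

/-- Translate: `∫_ℝ dy / (a² + (γ + y)²) = π / a` for `0 < a`. [folklore] -/
theorem integral_inv_sq_add_add_sq_eq_pi_div {a : ℝ} (ha : 0 < a) (γ : ℝ) :
    ∫ y : ℝ, (a ^ 2 + (γ + y) ^ 2)⁻¹ = π / a := by
  rw [integral_add_left_eq_self (fun y : ℝ => (a ^ 2 + y ^ 2)⁻¹) γ]
  exact integral_inv_sq_add_sq_eq_pi_div ha

/-- Translate: `y ↦ ((z - y)² + a²)⁻¹` is integrable for `a ≠ 0`. [folklore] -/
theorem integrable_inv_sub_sq_add_sq_of_ne_zero {a : ℝ} (ha : a ≠ 0) (z : ℝ) :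
    Integrable fun y : ℝ => ((z - y) ^ 2 + a ^ 2)⁻¹ :=
  (integrable_inv_sq_add_sq_of_ne_zero' ha).comp_sub_left z

/-- Translate: `y ↦ (a² + (γ + y)²)⁻¹` is integrable for `a ≠ 0`. [folklore] -/
theorem integrable_inv_sq_add_add_sq_of_ne_zero {a : ℝ} (ha : a ≠ 0) (γ : ℝ) :
    Integrable fun y : ℝ => (a ^ 2 + (γ + y) ^ 2)⁻¹ :=
  (integrable_inv_sq_add_sq_of_ne_zero ha).comp_add_left γ

end Literature.Analysis.SpecialFunctions
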